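import Mathlib.Algebra.Field.ZMod
import Mathlib.LinearAlgebra.Basis.VectorSpace
import Mathlib.LinearAlgebra.Dimension.Free
import Mathlib.LinearAlgebra.FiniteDimensional.Defs
import Mathlib.LinearAlgebra.Pi
import Mathlib.RingTheory.Finiteness.Basic
import Mathlib.Algebra.BigOperators.Ring.Finset
import Mathlib.Tactic.Ring
import Mathlib.Tactic.Abel
import HarnessLib

/-!
# Route ConvexRankGates, crux `Capture` (stmt-PneNP-2659), line `csp-spine-meet-to-join`, Stub C:
# quadratic sections of affine subspaces of `𝔽₂^ι`

The abstract fact behind "the central-layer condition of a coset constraint is a QUADRATIC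
POLYNOMIAL in the top-layer bits" (Theorem A of the line). Let `A ⊆ 𝔽₂^ι` be a nonempty affine
subspace (closed under `u + u' + u''`) and `φ : 𝔽₂^ι → 𝔽₂` a function whose second difference on
`A` is a bi-additive form `B`: for `u ∈ A` and directions `d, d'` with `u + d, u + d' ∈ A`,
`φ (u + d + d') + φ (u + d) + φ (u + d') + φ u = B d d'`. Then `φ` agrees on `A` with a
polynomial of degree `≤ 2`, `f₀ + ∑ i, f₁ i * u i + ∑ i, ∑ j, f₂ (i, j) * (u i * u j)`.

Proof: fix `u₀ ∈ A`; the directions `W = {d | u₀ + d ∈ A}` form a subspace, and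
`ψ d := φ (u₀ + d) + φ u₀` satisfies `ψ (d + d') = ψ d + ψ d' + B d d'` on `W`. Choosing a
basis `w a` of `W` and linear coordinate functionals `c a` on the whole space (a linear retraction
onto `W`), every `u ∈ A` is `u₀ + ∑ a, t a u • w a` with the AFFINE functions
`t a u = c a u + c a u₀`, and peeling off one basis direction at a time gives
`ψ (∑ a, t a u • w a) = ∑ a, t a u * ψ (w a) + ∑ (a before a'), t a u * t a' u * B (w a) (w a')`,
a sum of products of at most two affine functions, hence a quadratic polynomial in the bits `u i`.
[folklore]
-/

namespace Summit.PneNP.PneNP.Cruxes.Capture.CspSpineMeetToJoin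

set_option linter.dupNamespace false -- `Summit.PneNP.PneNP.…`: summit = sub-problem (D-0017)

/-- The sum of two quadratic polynomial functions of the bits is a quadratic polynomial function.
[folklore] -/
private theorem quad_add {ι : Type*} [Fintype ι] {g h : (ι → ZMod 2) → ZMod 2}
    (hg : ∃ (f₀ : ZMod 2) (f₁ : ι → ZMod 2) (f₂ : ι × ι → ZMod 2),
      ∀ u, g u = f₀ + ∑ i, f₁ i * u i + ∑ i, ∑ j, f₂ (i, j) * (u i * u j))
    (hh : ∃ (f₀ : ZMod 2) (f₁ : ι → ZMod 2) (f₂ : ι × ι → ZMod 2),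
      ∀ u, h u = f₀ + ∑ i, f₁ i * u i + ∑ i, ∑ j, f₂ (i, j) * (u i * u j)) :
    ∃ (f₀ : ZMod 2) (f₁ : ι → ZMod 2) (f₂ : ι × ι → ZMod 2),
      ∀ u, g u + h u = f₀ + ∑ i, f₁ i * u i + ∑ i, ∑ j, f₂ (i, j) * (u i * u j) := by
  obtain ⟨a₀, a₁, a₂, ha⟩ := hg
  obtain ⟨b₀, b₁, b₂, hb⟩ := hh
  refine ⟨a₀ + b₀, a₁ + b₁, a₂ + b₂, fun u => ?_⟩
  rw [ha, hb]
  simp only [Pi.add_apply, add_mul, Finset.sum_add_distrib]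
  ring

/-- A finite sum of quadratic polynomial functions of the bits is a quadratic polynomial function.
[folklore] -/
private theorem quad_sum {ι : Type*} [Fintype ι] {κ : Type*} (s : Finset κ)
    (g : κ → (ι → ZMod 2) → ZMod 2)
    (hg : ∀ k ∈ s, ∃ (f₀ : ZMod 2) (f₁ : ι → ZMod 2) (f₂ : ι × ι → ZMod 2),
      ∀ u, g k u = f₀ + ∑ i, f₁ i * u i + ∑ i, ∑ j, f₂ (i, j) * (u i * u j)) :
    ∃ (f₀ : ZMod 2) (f₁ : ι → ZMod 2) (f₂ : ι × ι → ZMod 2),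
      ∀ u, ∑ k ∈ s, g k u = f₀ + ∑ i, f₁ i * u i + ∑ i, ∑ j, f₂ (i, j) * (u i * u j) := by
  classical
  induction s using Finset.induction_on with
  | empty => exact ⟨0, 0, 0, fun u => by simp⟩
  | insert a s ha ih =>
    obtain ⟨f₀, f₁, f₂, hf⟩ := quad_add (hg a (Finset.mem_insert_self a s))
      (ih fun k hk => hg k (Finset.mem_insert_of_mem hk))
    exact ⟨f₀, f₁, f₂, fun u => by rw [Finset.sum_insert ha]; exact hf u⟩

/-- The product of two affine functions of the bits (a linear functional plus a constant) and a
constant is a quadratic polynomial function. [folklore] -/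
private theorem quad_mul {ι : Type*} [Fintype ι] [DecidableEq ι]
    (L₁ L₂ : (ι → ZMod 2) →ₗ[ZMod 2] ZMod 2) (α β c : ZMod 2) :
    ∃ (f₀ : ZMod 2) (f₁ : ι → ZMod 2) (f₂ : ι × ι → ZMod 2),
      ∀ u, (L₁ u + α) * (L₂ u + β) * c
        = f₀ + ∑ i, f₁ i * u i + ∑ i, ∑ j, f₂ (i, j) * (u i * u j) := by
  -- coefficients of the two linear functionals on the standard basis
  set p : ι → ZMod 2 := fun i => L₁ fun j => if i = j then 1 else 0 with hp
  set q : ι → ZMod 2 := fun i => L₂ fun j => if i = j then 1 else 0 with hq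
  have h₁ : ∀ u, L₁ u = ∑ i, p i * u i := fun u => by
    rw [LinearMap.pi_apply_eq_sum_univ]
    exact Finset.sum_congr rfl fun i _ => by rw [smul_eq_mul, mul_comm]
  have h₂ : ∀ u, L₂ u = ∑ i, q i * u i := fun u => by
    rw [LinearMap.pi_apply_eq_sum_univ]
    exact Finset.sum_congr rfl fun i _ => by rw [smul_eq_mul, mul_comm]
  refine ⟨α * β * c, fun i => c * (β * p i + α * q i), fun ij => c * p ij.1 * q ij.2, fun u => ?_⟩
  rw [h₁, h₂]
  have e₁ : (∑ i, p i * u i) * (∑ j, q j * u j) * c = ∑ i, ∑ j, c * p i * q j * (u i * u j) := by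
    rw [Finset.sum_mul_sum, Finset.sum_mul]
    refine Finset.sum_congr rfl fun i _ => ?_
    rw [Finset.sum_mul]
    exact Finset.sum_congr rfl fun j _ => by ring
  have e₂ : ∑ i, c * (β * p i + α * q i) * u i
      = (β * ∑ i, p i * u i + α * ∑ i, q i * u i) * c := by
    rw [Finset.mul_sum, Finset.mul_sum, ← Finset.sum_add_distrib, Finset.sum_mul]
    exact Finset.sum_congr rfl fun i _ => by ring
  rw [e₂, ← e₁]
  ring

/-- **Quadratic sections of affine subspaces** (binder form). `A ⊆ 𝔽₂^ι` nonempty and closed under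
`u + u' + u''`, `B` bi-additive, and the second difference of `φ` on `A` is `B`; then `φ` agrees on
`A` with a polynomial of degree `≤ 2` in the bits (sum over all ordered pairs `(i, j)`, diagonal
allowed). [folklore] -/
theorem quad_section' {ι : Type*} [Fintype ι] [DecidableEq ι] (A : Set (ι → ZMod 2))
    (φ : (ι → ZMod 2) → ZMod 2) (B : (ι → ZMod 2) → (ι → ZMod 2) → ZMod 2)
    (hB₁ : ∀ d₁ d₂ d' : ι → ZMod 2, B (d₁ + d₂) d' = B d₁ d' + B d₂ d')
    (hB₂ : ∀ d d₁' d₂' : ι → ZMod 2, B d (d₁' + d₂') = B d d₁' + B d d₂') (hA : A.Nonempty)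
    (hA₃ : ∀ u ∈ A, ∀ u' ∈ A, ∀ u'' ∈ A, u + u' + u'' ∈ A)
    (hφ : ∀ u ∈ A, ∀ d d' : ι → ZMod 2, u + d ∈ A → u + d' ∈ A →
      φ (u + d + d') + φ (u + d) + φ (u + d') + φ u = B d d') :
    ∃ (f₀ : ZMod 2) (f₁ : ι → ZMod 2) (f₂ : ι × ι → ZMod 2),
      ∀ u ∈ A, φ u = f₀ + ∑ i, f₁ i * u i + ∑ i, ∑ j, f₂ (i, j) * (u i * u j) := by
  -- arithmetic in `ZMod 2` (decided before any local instance enters the context)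
  have zmod2 : ∀ x : ZMod 2, x = 0 ∨ x = 1 := by decide
  have add_self : ∀ x : ZMod 2, x + x = 0 := by decide
  have e₂ : ∀ x y : ZMod 2, x = y + (x + y) := by decide
  have e₄ : ∀ x y z w : ZMod 2, x + y = z + y + (w + y) + (x + z + w + y) := by decide
  classical
  haveI : Fact (Nat.Prime 2) := ⟨Nat.prime_two⟩
  obtain ⟨u₀, hu₀⟩ := hA
  have vadd_self : ∀ v : ι → ZMod 2, v + v = 0 := fun v => funext fun i => add_self (v i)
  have hB0l : ∀ d' : ι → ZMod 2, B 0 d' = 0 := fun d' =>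
    calc B 0 d' = B 0 d' + B 0 d' := by simpa using hB₁ 0 0 d'
      _ = 0 := add_self _
  have hB0r : ∀ d : ι → ZMod 2, B d 0 = 0 := fun d =>
    calc B d 0 = B d 0 + B d 0 := by simpa using hB₂ d 0 0
      _ = 0 := add_self _
  have hBsmul : ∀ (σ τ : ZMod 2) (x y : ι → ZMod 2), B (σ • x) (τ • y) = σ * τ * B x y := by
    intro σ τ x y
    rcases zmod2 σ with rfl | rfl <;> rcases zmod2 τ with rfl | rfl <;> simp [hB0l, hB0r]
  -- the direction space `W` of the affine subspace `A` through `u₀`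
  let W : Submodule (ZMod 2) (ι → ZMod 2) :=
    { carrier := {d | u₀ + d ∈ A}
      zero_mem' := by simpa using hu₀
      add_mem' := by
        intro d d' hd hd'
        have e : u₀ + d + (u₀ + d') + u₀ = u₀ + (d + d') := by
          calc u₀ + d + (u₀ + d') + u₀ = u₀ + u₀ + (u₀ + (d + d')) := by abel
            _ = u₀ + (d + d') := by rw [vadd_self, zero_add]
        have h := hA₃ _ hd _ hd' _ hu₀
        rw [e] at h
        exact h
      smul_mem' := by
        intro c d hd
        rcases zmod2 c with rfl | rfl
        · rw [zero_smul]; show u₀ + 0 ∈ A; rw [add_zero]; exact hu₀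
        · rw [one_smul]; exact hd }
  -- polarisation of `ψ d := φ (u₀ + d) + φ u₀` on `W`
  have hpol : ∀ d ∈ W, ∀ d' ∈ W, φ (u₀ + (d + d')) + φ u₀
      = (φ (u₀ + d) + φ u₀) + (φ (u₀ + d') + φ u₀) + B d d' := by
    intro d hd d' hd'
    have h := hφ u₀ hu₀ d d' hd hd'
    rw [add_assoc u₀ d d'] at h
    rw [← h]
    exact e₄ _ _ _ _
  -- linear coordinates: a basis `b` of `W` and a linear retraction `g` onto `W`
  obtain ⟨g, hg⟩ := LinearMap.exists_leftInverse_of_injective W.subtype W.ker_subtype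
  let b := Module.finBasis (ZMod 2) W
  let m : ℕ := Module.finrank (ZMod 2) W
  let cf : Fin m → (ι → ZMod 2) →ₗ[ZMod 2] ZMod 2 := fun a => (b.coord a).comp g
  let w : Fin m → ι → ZMod 2 := fun a => (b a : ι → ZMod 2)
  have hw : ∀ a, w a ∈ W := fun a => (b a).2
  have hcoord : ∀ d ∈ W, ∑ a, cf a d • w a = d := by
    intro d hd
    have hgd : g d = ⟨d, hd⟩ := by
      have := LinearMap.congr_fun hg ⟨d, hd⟩
      simpa using this
    have h := congrArg (Subtype.val : W → ι → ZMod 2) (b.sum_repr ⟨d, hd⟩)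
    simp only [Submodule.coe_sum, Submodule.coe_smul] at h
    simpa [cf, w, hgd] using h
  -- the affine coordinates `t a u = cf a (u + u₀)` of a point `u`, and their quadratic closure
  let t : Fin m → (ι → ZMod 2) → ZMod 2 := fun a u => cf a u + cf a u₀
  have ht₁ : ∀ a (c : ZMod 2), ∃ (f₀ : ZMod 2) (f₁ : ι → ZMod 2) (f₂ : ι × ι → ZMod 2),
      ∀ u, t a u * c = f₀ + ∑ i, f₁ i * u i + ∑ i, ∑ j, f₂ (i, j) * (u i * u j) := by
    intro a c
    obtain ⟨f₀, f₁, f₂, hf⟩ := quad_mul (cf a) 0 (cf a u₀) 1 c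
    exact ⟨f₀, f₁, f₂, fun u => by rw [← hf u]; simp [t]⟩
  have ht₂ : ∀ a a' (c : ZMod 2), ∃ (f₀ : ZMod 2) (f₁ : ι → ZMod 2) (f₂ : ι × ι → ZMod 2),
      ∀ u, t a u * t a' u * c = f₀ + ∑ i, f₁ i * u i + ∑ i, ∑ j, f₂ (i, j) * (u i * u j) :=
    fun a a' c => quad_mul (cf a) (cf a') (cf a u₀) (cf a' u₀) c
  -- KEY: `ψ (∑ a ∈ s, t a u • w a)` is a quadratic polynomial in `u` (peel off one direction)
  have key : ∀ s : Finset (Fin m), ∃ (f₀ : ZMod 2) (f₁ : ι → ZMod 2) (f₂ : ι × ι → ZMod 2),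
      ∀ u, φ (u₀ + ∑ a ∈ s, t a u • w a) + φ u₀
        = f₀ + ∑ i, f₁ i * u i + ∑ i, ∑ j, f₂ (i, j) * (u i * u j) := by
    intro s
    induction s using Finset.induction_on with
    | empty => exact ⟨0, 0, 0, fun u => by simp [add_self]⟩
    | insert a s ha ih =>
      have hS : ∀ u, ∑ a' ∈ s, t a' u • w a' ∈ W := fun u =>
        W.sum_mem fun a' _ => W.smul_mem _ (hw a')
      have hT : ∀ u, t a u • w a ∈ W := fun u => W.smul_mem _ (hw a)
      have hBs : ∀ u, B (t a u • w a) (∑ a' ∈ s, t a' u • w a')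
          = ∑ a' ∈ s, t a u * t a' u * B (w a) (w a') := by
        intro u
        have := map_sum (AddMonoidHom.mk' (fun d' => B (t a u • w a) d') fun x y => hB₂ _ x y)
          (fun a' => t a' u • w a') s
        simp only [AddMonoidHom.mk'_apply] at this
        rw [this]
        exact Finset.sum_congr rfl fun a' _ => hBsmul _ _ _ _
      have step : ∀ u, φ (u₀ + ∑ a' ∈ insert a s, t a' u • w a') + φ u₀
          = t a u * (φ (u₀ + w a) + φ u₀) + (φ (u₀ + ∑ a' ∈ s, t a' u • w a') + φ u₀)
            + ∑ a' ∈ s, t a u * t a' u * B (w a) (w a') := by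
        intro u
        rw [Finset.sum_insert ha, hpol _ (hT u) _ (hS u), hBs u]
        congr 2
        rcases zmod2 (t a u) with h | h <;> rw [h] <;> simp [add_self]
      obtain ⟨r₀, r₁, r₂, hr⟩ := quad_sum s (fun a' u => t a u * t a' u * B (w a) (w a'))
        fun a' _ => ht₂ a a' _
      obtain ⟨f₀, f₁, f₂, hf⟩ :=
        quad_add (quad_add (ht₁ a (φ (u₀ + w a) + φ u₀)) ih) ⟨r₀, r₁, r₂, hr⟩
      exact ⟨f₀, f₁, f₂, fun u => by rw [step u]; exact hf u⟩
  -- assemble: `u = u₀ + ∑ a, t a u • w a` for `u ∈ A`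
  obtain ⟨f₀, f₁, f₂, hf⟩ := key Finset.univ
  refine ⟨φ u₀ + f₀, f₁, f₂, fun u hu => ?_⟩
  have e : u₀ + (u + u₀) = u := by
    calc u₀ + (u + u₀) = u + (u₀ + u₀) := by abel
      _ = u := by rw [vadd_self, add_zero]
  have hd : u + u₀ ∈ W := by
    show u₀ + (u + u₀) ∈ A
    rw [e]
    exact hu
  have hu' : u₀ + ∑ a, t a u • w a = u := by
    have h1 : ∀ a, t a u = cf a (u + u₀) := fun a => by simp [t, map_add]
    simp only [h1]
    rw [hcoord _ hd, e]
  calc φ u = φ u₀ + (φ (u₀ + ∑ a, t a u • w a) + φ u₀) := by rw [hu']; exact e₂ _ _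
    _ = φ u₀ + f₀ + ∑ i, f₁ i * u i + ∑ i, ∑ j, f₂ (i, j) * (u i * u j) := by
      rw [hf u]; ring

/-- **Quadratic sections of affine subspaces** (registered sub-goal `quad_section` of
stmt-PneNP-2659, stated as one closed proposition): see `quad_section'`. [folklore] -/
theorem quad_section : ∀ (ι : Type) [Fintype ι] [DecidableEq ι] (A : Set (ι → ZMod 2))
    (φ : (ι → ZMod 2) → ZMod 2) (B : (ι → ZMod 2) → (ι → ZMod 2) → ZMod 2),
    (∀ d₁ d₂ d' : ι → ZMod 2, B (d₁ + d₂) d' = B d₁ d' + B d₂ d') →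
    (∀ d d₁' d₂' : ι → ZMod 2, B d (d₁' + d₂') = B d d₁' + B d d₂') → A.Nonempty →
    (∀ u ∈ A, ∀ u' ∈ A, ∀ u'' ∈ A, u + u' + u'' ∈ A) →
    (∀ u ∈ A, ∀ d d' : ι → ZMod 2, u + d ∈ A → u + d' ∈ A →
      φ (u + d + d') + φ (u + d) + φ (u + d') + φ u = B d d') →
    ∃ (f₀ : ZMod 2) (f₁ : ι → ZMod 2) (f₂ : ι × ι → ZMod 2),
      ∀ u ∈ A, φ u = f₀ + ∑ i, f₁ i * u i + ∑ i, ∑ j, f₂ (i, j) * (u i * u j) :=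
  fun _ _ _ A φ B hB₁ hB₂ hA hA₃ hφ => quad_section' A φ B hB₁ hB₂ hA hA₃ hφ

end Summit.PneNP.PneNP.Cruxes.Capture.CspSpineMeetToJoin
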